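import Mathlib
import HarnessLib
import Summits.NavierStokesRegularity.NavierStokesRegularity.Theorems.HalfSpaceWindowDoorCirculationCarryingRigidityDefs
import Summits.NavierStokesRegularity.NavierStokesRegularity.Theorems.HalfSpaceWindowDoorCirculationCarryingRigiditySubcriticalStretching
import Summits.NavierStokesRegularity.NavierStokesRegularity.Theorems.HalfSpaceWindowDoorCirculationCarryingRigidityExtremalProfile
import Summits.NavierStokesRegularity.NavierStokesRegularity.Theorems.HalfSpaceWindowDoorCirculationCarryingRigidityExtremalInvariant
import Summits.NavierStokesRegularity.NavierStokesRegularity.Theorems.HalfSpaceWindowDoorCirculationCarryingRigidityReduction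
import Summits.NavierStokesRegularity.NavierStokesRegularity.Theorems.PoloidalWindowDoorPoloidalWindowRigidityStrongMaxPrinciple
import Summits.NavierStokesRegularity.NavierStokesRegularity.Theorems.PoloidalWindowDoorPoloidalWindowRigidityWindow
import Summits.NavierStokesRegularity.NavierStokesRegularity.Theorems.ChiralWindowDoorClassDerivDecay

/-!
# Route `HalfSpaceWindowDoor`, crux `CirculationCarryingRigidity` (stmt-NavierStokesRegularity-25311) —
# CRITICAL `e₃`-STRETCHING EXCLUSION: the similarity rate itself is excluded (strong maximum principle)

The open research stub of 25311 is `NoExtremalHemisphereProfile ≡ HemisphereLiouvilleE3 ≡ StubLayerExclusion`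
(closed-hemisphere profiles of the route's Type-I ancient Oseen-mild class, `⟪curl v, e₃⟫ ≥ 0`, are poloidal along
`e₃`).  `…SubcriticalStretching` settled the stratum where the `e₃`-stretching `σ = ⟪Dv[curl v], e₃⟫` is
SUBCRITICAL, `(−s)σ ≤ θ ω₃` with `θ < 1` (weak maximum principle for `(−s)^θ ω₃ → 0`).  This file closes the
borderline `θ = 1` — the SIMILARITY RATE — which the weak principle cannot see, and shows the bound only matters on
the support of `ω₃`:

* `weighted_eq_of_extremal_of_critical` — **strong maximum principle**: for an extremal profile (`(−s)ω₃ ≤ M`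
  everywhere, `= M` at `(−1,0)`) obeying the critical bound on `[−2,−1] × ℝ³`, `w = (−s)ω₃` is a sub-solution of
  `∂ₛw + Dw[v] − Δw = (−s)σ − ω₃ ≤ 0` with bounded (Type-I) drift attaining its supremum at the top interior point,
  so `w ≡ M` on the slab (tree `…StrongMaxPrinciple.eq_of_interior_max`, Nirenberg 1953);
* `false_of_inner_curl_e3_eq_const` — a closed-hemisphere class profile cannot have a CONSTANT POSITIVE `ω₃` on a
  whole slice: the plane-disc circulation would grow like `L²`, against the Type-I Stokes bound `≲ C L/√(−s)`
  (`…Reduction.setLIntegral_ball_inner_curl_e3_le`);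
* `not_extremal_of_critical_stretching`, `inner_curl_e3_eq_zero_of_critical_stretching` — **CRITICAL-STRETCHING
  EXCLUSION**: a closed-hemisphere profile of the class with `(−s)·⟪Dv(s,y)[curl v(s,y)], e₃⟫ ≤ ⟪curl v(s,y), e₃⟫`
  for all `s < 0`, `y` is poloidal along `e₃` (`θ ≤ 1` now INCLUDED; the extremal companion inherits the bound by
  `…ExtremalInvariant.exists_extremal_of_invariant`);
* `inner_stretch_nonpos_of_inner_curl_e3_eq_zero` — at a ZERO of `ω₃` of a closed-hemisphere profile the
  `e₃`-stretching is `≤ 0` (first/second-order conditions at a minimum + the `e₃`-vorticity equation), whence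
  `inner_curl_e3_eq_zero_of_critical_stretching_on_pos`: the critical bound is needed only where `ω₃ > 0`;
* `exists_strictly_supercritical_stretching_of_pos` — census form: a circulation-carrying closed-hemisphere profile
  is stretched STRICTLY FASTER than the similarity rate at some point where `ω₃ > 0`.

Seat ns-hsw-p1 g2 (LEAD of 25311, cell pub-ns-dss; helper `--supports` 25311).  WHAT THIS IS NOT: not a statement
about Navier–Stokes regularity — the door statements are regularity CRITERIA about HYPOTHETICAL blow-up profiles; a
settled stratum of the open stub, not its closure.
-/

noncomputable section

-- the summit and its single sub-problem share the name (CONVENTIONS §1), as in every Theorems file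
set_option linter.dupNamespace false

namespace Summit.NavierStokesRegularity.NavierStokesRegularity.Theorems.HalfSpaceWindowDoorCirculationCarryingRigidityCriticalStretching

open MeasureTheory Set Function Filter Topology Metric
open scoped RealInnerProductSpace InnerProductSpace Laplacian ContDiff ENNReal
open Literature.Analysis Literature.Analysis.FluidPDE
open Summit.NavierStokesRegularity.NavierStokesRegularity.Theorems
open Summit.NavierStokesRegularity.NavierStokesRegularity.Theorems.HalfSpaceWindowDoorCirculationCarryingRigidityDefs
open Summit.NavierStokesRegularity.NavierStokesRegularity.Theorems.HalfSpaceWindowDoorCirculationCarryingRigiditySubcriticalStretching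
  (hasDerivAt_inner_curl_e3)
open Summit.NavierStokesRegularity.NavierStokesRegularity.Theorems.HalfSpaceWindowDoorCirculationCarryingRigidityExtremalProfile
  (sign_zoom tendsto_inner_curl_e3_of_tendsto_fderiv)
open Summit.NavierStokesRegularity.NavierStokesRegularity.Theorems.HalfSpaceWindowDoorCirculationCarryingRigidityExtremalInvariant
  (critical_zoom critical_lim exists_extremal_of_invariant)
open Summit.NavierStokesRegularity.NavierStokesRegularity.Theorems.HalfSpaceWindowDoorCirculationCarryingRigidityReduction
  (setLIntegral_ball_inner_curl_e3_le)
open Summit.NavierStokesRegularity.NavierStokesRegularity.Theorems.PoloidalWindowDoorPoloidalWindowRigidityStrongMaxPrinciple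
  (eq_of_interior_max)
open Summit.NavierStokesRegularity.NavierStokesRegularity.Theorems.PoloidalWindowDoorPoloidalWindowRigidityWindow
  (isTypeIAncientMild_of_class)
open Summit.NavierStokesRegularity.NavierStokesRegularity.Theorems.ChiralWindowDoorClassDerivDecay (exists_classical_of_class)

/-! ### The strong maximum principle at the extremal point under the critical bound -/

variable {C M : ℝ} {W : ℝ → EuclideanSpace ℝ (Fin 3) → EuclideanSpace ℝ (Fin 3)}

/-- **`(−s)ω₃ ≡ M` on the slab `[−2,−1] × ℝ³` for a critically stretched extremal profile.**  Let `W` be a profile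
of the class with `(−s)·⟪curl W(s)(y), e₃⟫ ≤ M` everywhere and `= M` at `(−1, 0)`, whose `e₃`-stretching obeys the
critical bound `(−s)·⟪DW(s,y)[curl W(s,y)], e₃⟫ ≤ ⟪curl W(s,y), e₃⟫` on the slab `[−2,−1] × ℝ³`.  Then
`(−s)·⟪curl W(s)(y), e₃⟫ = M` for all `s ∈ [−2,−1]`, `y`.  (By the `e₃`-vorticity equation, `w = (−s)ω₃` satisfies
`∂ₛw + Dw[W] − Δw = (−s)σ − ω₃ ≤ 0`; the drift `W` is bounded by `C` on the slab; Nirenberg's strong maximum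
principle `eq_of_interior_max`.) [cite: Lieberman1996, Ch. II Thm. 2.7] -/
theorem weighted_eq_of_extremal_of_critical (hrate : HasTypeITimeDecay C W)
    (hcont : ContinuousOn (uncurry W) (Iio (0 : ℝ) ×ˢ univ))
    (hmild : ∀ s t : ℝ, s < t → t < 0 → ∀ x,
      W t x = UnboundedOperators.heatExtension (W s) (t - s) x - oseenDuhamel 1 s W W t x)
    (hdiv : ∀ t < 0, VectorCalculus.IsDivFree (W t))
    (hmax : ∀ s < 0, ∀ y, (-s) * ⟪curl (W s) y, e3⟫ ≤ M) (hval : ⟪curl (W (-1)) 0, e3⟫ = M)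
    (hcrit : ∀ s ∈ Icc (-2 : ℝ) (-1), ∀ y,
      (-s) * ⟪fderiv ℝ (W s) y (curl (W s) y), e3⟫ ≤ ⟪curl (W s) y, e3⟫) :
    ∀ s ∈ Icc (-2 : ℝ) (-1), ∀ y, (-s) * ⟪curl (W s) y, e3⟫ = M := by
  -- the class is classical, hence a vorticity solution on `(−∞,0)`
  obtain ⟨q, hcl⟩ := exists_classical_of_class hrate hcont hmild hdiv
  have hS : IsOpen (Iio (0 : ℝ)) := isOpen_Iio
  have hV : IsVorticitySolutionOn (Iio (0 : ℝ)) 1 W :=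
    hcl.isVorticitySolutionOn_zero_force hS.uniqueDiffOn (by rw [interior_Iio]; exact subset_closure)
  have hω : IsSmoothSpaceTimeOn (Iio (0 : ℝ)) (vorticity W) :=
    hV.smooth_velocity.isSmoothSpaceTimeOn_vorticity hS.uniqueDiffOn
  have hω3s : IsSmoothSpaceTimeOn (Iio (0 : ℝ)) fun t y => ⟪curl (W t) y, e3⟫ :=
    hω.inner (isSmoothSpaceTimeOn_const_time contDiff_const _)
  have hneg : IsSmoothSpaceTimeOn (Iio (0 : ℝ)) fun (t : ℝ) (_ : EuclideanSpace ℝ (Fin 3)) => -t :=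
    fun p _ => (contDiff_fst (𝕜 := ℝ) (E := ℝ) (F := EuclideanSpace ℝ (Fin 3))).neg.contDiffAt.contDiffWithinAt
  -- the weighted component and its time derivative
  set w : ℝ → EuclideanSpace ℝ (Fin 3) → ℝ := fun t y => (-t) * ⟪curl (W t) y, e3⟫ with hw
  set wt : ℝ → EuclideanSpace ℝ (Fin 3) → ℝ := fun t y =>
    -1 * ⟪curl (W t) y, e3⟫ +
      (-t) * ((Δ fun z => ⟪curl (W t) z, e3⟫) y - fderiv ℝ (fun z => ⟪curl (W t) z, e3⟫) y (W t y)
        + ⟪fderiv ℝ (W t) y (curl (W t) y), e3⟫) with hwt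
  have hws : IsSmoothSpaceTimeOn (Iio (0 : ℝ)) w := hneg.mul hω3s
  have hslab : Icc (-2 : ℝ) (-1) ×ˢ (univ : Set (EuclideanSpace ℝ (Fin 3))) ⊆ Iio 0 ×ˢ univ :=
    prod_mono (fun t ht => lt_of_le_of_lt ht.2 (by norm_num)) le_rfl
  have hIcc : ∀ t ∈ Icc (-2 : ℝ) (-1), t < 0 := fun t ht => lt_of_le_of_lt ht.2 (by norm_num)
  have hw_c : ContinuousOn (uncurry w) (Icc (-2 : ℝ) (-1) ×ˢ univ) := hws.continuousOn.mono hslab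
  have hw2 : ∀ t ∈ Icc (-2 : ℝ) (-1), ContDiff ℝ 2 (w t) := fun t ht =>
    (hws.contDiff_slice (hIcc t ht)).of_le (by norm_cast)
  have hwt' : ∀ y, ∀ t ∈ Icc (-2 : ℝ) (-1), HasDerivAt (fun s => w s y) (wt t y) t := by
    intro y t ht
    have h := (hasDerivAt_neg' (x := t)).fun_mul (hasDerivAt_inner_curl_e3 hV (hIcc t ht) y)
    simpa only [hw, hwt] using h
  -- the sub-solution inequality `∂ₛw + Dw[W] − Δw ≤ 0` on the slab
  have hlaw : ∀ t ∈ Icc (-2 : ℝ) (-1), ∀ y, wt t y + fderiv ℝ (w t) y (W t y) - (Δ (w t)) y ≤ 0 := by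
    intro t ht y
    have ht0 : t < 0 := hIcc t ht
    have hωt2 : ContDiff ℝ 2 fun z => ⟪curl (W t) z, e3⟫ := (hω3s.contDiff_slice ht0).of_le (by norm_cast)
    have hfun : w t = (-t) • fun z => ⟪curl (W t) z, e3⟫ := by
      funext z; simp only [hw, Pi.smul_apply, smul_eq_mul]
    have hΔ : (Δ (w t)) y = (-t) * (Δ fun z => ⟪curl (W t) z, e3⟫) y := by
      rw [hfun, InnerProductSpace.laplacian_smul _ hωt2.contDiffAt, smul_eq_mul]
    have hD : fderiv ℝ (w t) y (W t y) = (-t) * fderiv ℝ (fun z => ⟪curl (W t) z, e3⟫) y (W t y) := by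
      rw [hfun, fderiv_const_smul (hωt2.differentiable two_ne_zero y)]
      simp only [FunLike.coe_smul, Pi.smul_apply, smul_eq_mul]
    rw [hΔ, hD]
    simp only [hwt]
    nlinarith [hcrit t ht y]
  -- the drift bound `‖W‖ ≤ C` on the slab and `w ≤ M`
  have hC0 : 0 ≤ C := by
    have h := hrate (-1) (by norm_num) 0
    rw [neg_neg, Real.sqrt_one, div_one] at h
    exact (norm_nonneg _).trans h
  have hbA : ∀ t ∈ Icc (-2 : ℝ) (-1), ∀ x, ‖W t x‖ ≤ C := by
    intro t ht x
    refine (hrate t (hIcc t ht) x).trans (div_le_self hC0 ?_)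
    exact Real.one_le_sqrt.2 (by linarith [ht.2])
  have hle : ∀ t ∈ Icc (-2 : ℝ) (-1), ∀ x, w t x ≤ M := fun t ht x => hmax t (hIcc t ht) x
  have hts : (-1 : ℝ) ∈ Ioc (-2 : ℝ) (-1) := ⟨by norm_num, le_rfl⟩
  have hmaxpt : w (-1) 0 = M := by simp only [hw, hval]; ring
  intro s hs y
  exact eq_of_interior_max hbA hw_c hw2 hwt' hlaw hle hts hmaxpt s hs y

/-! ### A constant positive `ω₃` on a slice contradicts the Type-I Stokes bound -/

/-- **No constant positive `e₃`-vorticity on a slice.**  A closed-hemisphere profile of the class cannot have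
`⟪curl v(s₀)(y), e₃⟫ = m > 0` for ALL `y` at some `s₀ < 0`: the disc integral `∫_(|y_h|<L) ω₃ = π L² m` would
exceed the Type-I Stokes bound `16π e^{1/4} C L/√(−s₀)` of `setLIntegral_ball_inner_curl_e3_le` for large `L`.
[folklore] -/
theorem false_of_inner_curl_e3_eq_const {v : ℝ → EuclideanSpace ℝ (Fin 3) → EuclideanSpace ℝ (Fin 3)} {m s₀ : ℝ}
    (hrate : HasTypeITimeDecay C v) (hcont : ContinuousOn (uncurry v) (Iio (0 : ℝ) ×ˢ univ))
    (hmild : ∀ s t : ℝ, s < t → t < 0 → ∀ x,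
      v t x = UnboundedOperators.heatExtension (v s) (t - s) x - oseenDuhamel 1 s v v t x)
    (hdiv : ∀ t < 0, VectorCalculus.IsDivFree (v t)) (hnn : ∀ s < 0, ∀ y, 0 ≤ ⟪curl (v s) y, e3⟫)
    (hs₀ : s₀ < 0) (hm : 0 < m) (hconst : ∀ y, ⟪curl (v s₀) y, e3⟫ = m) : False := by
  set A : ℝ := 16 * Real.pi * Real.exp (1 / 4 : ℝ) * C / Real.sqrt (-s₀) with hA
  -- the unit disc has positive finite measure
  set V : ℝ≥0∞ := volume (ball (0 : EuclideanSpace ℝ (Fin 2)) 1) with hV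
  have hVpos : 0 < V := measure_ball_pos volume _ one_pos
  have hVtop : V ≠ (⊤ : ℝ≥0∞) := measure_ball_lt_top.ne
  have hv0 : 0 < V.toReal := ENNReal.toReal_pos hVpos.ne' hVtop
  -- the bound for every radius: `m · L² · |B₁| ≤ A · L`
  have hbd : ∀ L : ℝ, 0 < L → m * L ^ 2 * V.toReal ≤ A * L := by
    intro L hL
    have h := setLIntegral_ball_inner_curl_e3_le C v hrate hcont hmild hdiv hnn s₀ hs₀ L hL 0 0
    have hconst' : ∫⁻ y in ball (0 : EuclideanSpace ℝ (Fin 2)) L, ENNReal.ofReal ⟪curl (v s₀) (planePt 0 y), e3⟫ =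
        ENNReal.ofReal m * volume (ball (0 : EuclideanSpace ℝ (Fin 2)) L) := by
      simp_rw [hconst]
      rw [setLIntegral_const]
    have hball : volume (ball (0 : EuclideanSpace ℝ (Fin 2)) L) = ENNReal.ofReal (L ^ 2) * V := by
      rw [hV, Measure.addHaar_ball_of_pos volume (0 : EuclideanSpace ℝ (Fin 2)) hL, finrank_euclideanSpace,
        Fintype.card_fin]
    have hAL' : 16 * Real.pi * Real.exp (1 / 4 : ℝ) * C * L / Real.sqrt (-s₀) = A * L := by rw [hA]; ring
    rw [hconst', hball, hAL'] at h
    have hfin : ENNReal.ofReal m * (ENNReal.ofReal (L ^ 2) * V) ≠ (⊤ : ℝ≥0∞) :=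
      ENNReal.mul_ne_top ENNReal.ofReal_ne_top (ENNReal.mul_ne_top ENNReal.ofReal_ne_top hVtop)
    have h' := (ENNReal.toReal_le_toReal hfin ENNReal.ofReal_ne_top).2 h
    rw [ENNReal.toReal_mul, ENNReal.toReal_mul, ENNReal.toReal_ofReal hm.le,
      ENNReal.toReal_ofReal (sq_nonneg L)] at h'
    have hAL : (ENNReal.ofReal (A * L)).toReal = A * L ∨ A * L < 0 := by
      rcases le_or_gt 0 (A * L) with h0 | h0
      · exact Or.inl (ENNReal.toReal_ofReal h0)
      · exact Or.inr h0
    rcases hAL with hAL | hAL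
    · rw [hAL] at h'; linarith
    · -- impossible: the left side is nonnegative and `toReal ≥ 0`
      have : (0 : ℝ) ≤ (ENNReal.ofReal (A * L)).toReal := ENNReal.toReal_nonneg
      rw [ENNReal.ofReal_of_nonpos hAL.le, ENNReal.toReal_zero] at h'
      nlinarith [mul_pos (mul_pos hm (pow_pos hL 2)) hv0]
  -- take `L` beyond `A / (m |B₁|)`
  set L : ℝ := |A| / (m * V.toReal) + 1 with hL
  have hLpos : 0 < L := by positivity
  have h := hbd L hLpos
  have hmv : 0 < m * V.toReal := mul_pos hm hv0
  have h1 : m * L ^ 2 * V.toReal = (m * V.toReal) * L * L := by ring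
  rw [h1] at h
  have h2 : (m * V.toReal) * L ≤ A := le_of_mul_le_mul_right (by linarith) hLpos
  have h3 : (m * V.toReal) * L = |A| + m * V.toReal := by rw [hL]; field_simp
  linarith [le_abs_self A]

/-! ### Critical-stretching exclusion -/

/-- **No critically stretched extremal profile** (door vocabulary, the `θ = 1` case the weak maximum principle of
`…SubcriticalStretching` cannot reach).  A closed-hemisphere profile of the class with `(−s)ω₃ ≤ M` everywhere,
`ω₃(−1,0) = M > 0`, and `(−s)·⟪DW[curl W], e₃⟫ ≤ ⟪curl W, e₃⟫` on `[−2,−1] × ℝ³` does not exist: the strong maximum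
principle makes `ω₃(−2, ·) ≡ M/2`, a constant positive slice, against `false_of_inner_curl_e3_eq_const`.
[cite: Lieberman1996, Ch. II Thm. 2.7] -/
theorem not_extremal_of_critical_stretching (hrate : HasTypeITimeDecay C W)
    (hcont : ContinuousOn (uncurry W) (Iio (0 : ℝ) ×ˢ univ))
    (hmild : ∀ s t : ℝ, s < t → t < 0 → ∀ x,
      W t x = UnboundedOperators.heatExtension (W s) (t - s) x - oseenDuhamel 1 s W W t x)
    (hdiv : ∀ t < 0, VectorCalculus.IsDivFree (W t)) (hnn : ∀ s < 0, ∀ y, 0 ≤ ⟪curl (W s) y, e3⟫)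
    (hM : 0 < M) (hmax : ∀ s < 0, ∀ y, (-s) * ⟪curl (W s) y, e3⟫ ≤ M) (hval : ⟪curl (W (-1)) 0, e3⟫ = M)
    (hcrit : ∀ s ∈ Icc (-2 : ℝ) (-1), ∀ y,
      (-s) * ⟪fderiv ℝ (W s) y (curl (W s) y), e3⟫ ≤ ⟪curl (W s) y, e3⟫) : False := by
  have h := weighted_eq_of_extremal_of_critical hrate hcont hmild hdiv hmax hval hcrit (-2)
    ⟨le_rfl, by norm_num⟩
  refine false_of_inner_curl_e3_eq_const (m := M / 2) (s₀ := -2) hrate hcont hmild hdiv hnn (by norm_num)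
    (by positivity) fun y => ?_
  have hy := h y
  linarith

/-- **CRITICAL `e₃`-STRETCHING EXCLUSION (stratum of the open stub `NoExtremalHemisphereProfile ≡
HemisphereLiouvilleE3`, similarity rate INCLUDED).**  A closed-hemisphere profile of the route's Type-I ancient
Oseen-mild class whose `e₃`-vorticity is stretched AT MOST at the similarity rate,
`(−s)·⟪Dv(s,y)[curl v(s,y)], e₃⟫ ≤ ⟪curl v(s,y), e₃⟫` for all `s < 0`, `y`, is poloidal along `e₃`: `⟪curl v, e₃⟫ ≡ 0`.
(If `ω₃ > 0` somewhere, `exists_extremal_of_invariant` for the zoom-invariant, limit-closed sub-class «closed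
hemisphere + critical bound» gives a critically stretched extremal profile, excluded by
`not_extremal_of_critical_stretching`.) [cite: Lieberman1996, Ch. II Thm. 2.7; KochNadirashviliSereginSverak2009, Prop. 4.1] -/
theorem inner_curl_e3_eq_zero_of_critical_stretching :
    ∀ (C : ℝ) (v : ℝ → EuclideanSpace ℝ (Fin 3) → EuclideanSpace ℝ (Fin 3)),
    Literature.Analysis.FluidPDE.HasTypeITimeDecay C v →
    ContinuousOn (Function.uncurry v) (Set.Iio (0 : ℝ) ×ˢ Set.univ) →
    (∀ s t : ℝ, s < t → t < 0 → ∀ x, v t x =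
      Literature.Analysis.UnboundedOperators.heatExtension (v s) (t - s) x -
        Literature.Analysis.FluidPDE.oseenDuhamel 1 s v v t x) →
    (∀ t < 0, Literature.Analysis.FluidPDE.VectorCalculus.IsDivFree (v t)) →
    (∀ s < 0, ∀ y, 0 ≤ ⟪Literature.Analysis.FluidPDE.curl (v s) y, e3⟫_ℝ) →
    (∀ s < 0, ∀ y, (-s) * ⟪fderiv ℝ (v s) y (Literature.Analysis.FluidPDE.curl (v s) y), e3⟫_ℝ ≤
      ⟪Literature.Analysis.FluidPDE.curl (v s) y, e3⟫_ℝ) →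
    ∀ s < 0, ∀ y, ⟪Literature.Analysis.FluidPDE.curl (v s) y, e3⟫_ℝ = 0 := by
  intro C v hrate hcont hmild hdiv hnn hcrit s hs y
  by_contra hne
  have hpos : 0 < ⟪curl (v s) y, e3⟫ := lt_of_le_of_ne (hnn s hs y) (Ne.symm hne)
  have hv : IsTypeIAncientMild C v := isTypeIAncientMild_of_class hrate hcont hmild hdiv
  -- the invariant sub-class: closed hemisphere + critical stretching bound
  set Q : (ℝ → EuclideanSpace ℝ (Fin 3) → EuclideanSpace ℝ (Fin 3)) → Prop := fun u =>
    (∀ t < 0, ∀ x, 0 ≤ ⟪curl (u t) x, e3⟫) ∧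
      ∀ t < 0, ∀ x, (-t) * ⟪fderiv ℝ (u t) x (curl (u t) x), e3⟫ ≤ ⟪curl (u t) x, e3⟫ with hQ
  have hQzoom : ∀ u, IsTypeIAncientMild C u → Q u → ∀ c : ℝ, 0 < c → ∀ x₀ : EuclideanSpace ℝ (Fin 3),
      Q (c • stPull (c ^ 2) c 0 x₀ u) :=
    fun u hu huq c hc x₀ => ⟨sign_zoom huq.1 hc x₀, critical_zoom hu huq.2 hc x₀⟩
  have hQlim : ∀ (w : ℕ → ℝ → EuclideanSpace ℝ (Fin 3) → EuclideanSpace ℝ (Fin 3))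
      (W : ℝ → EuclideanSpace ℝ (Fin 3) → EuclideanSpace ℝ (Fin 3)),
      (∀ j, IsTypeIAncientMild C (w j)) → (∀ j, Q (w j)) → IsTypeIAncientMild C W →
      (∀ t < 0, ∀ x, Tendsto (fun j => fderiv ℝ (w j t) x) atTop (𝓝 (fderiv ℝ (W t) x))) → Q W := by
    intro w W _ hwq _ hD
    refine ⟨fun t ht x => ?_, critical_lim (fun j => (hwq j).2) hD⟩
    exact ge_of_tendsto' (tendsto_inner_curl_e3_of_tendsto_fderiv (hD t ht x)) fun j => (hwq j).1 t ht x
  obtain ⟨W, hW, hWq, M, hM, hMW, hmax⟩ := exists_extremal_of_invariant C Q hQzoom hQlim hv ⟨hnn, hcrit⟩ hs hpos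
  exact not_extremal_of_critical_stretching hW.hasTypeITimeDecay hW.continuousOn_uncurry
    (fun s t hst ht x => hW.mild_eq_heatExtension hst ht x) (fun t ht => hW.isDivFree ht) hWq.1 hM
    (hmax W hW hWq) hMW fun s hs y => hWq.2 s (lt_of_le_of_lt hs.2 (by norm_num)) y

/-! ### The critical bound is needed only on the support of `ω₃` -/

/-- **At a zero of `ω₃` the `e₃`-stretching is nonpositive.**  For a closed-hemisphere profile of the class and a point
`(s, y)`, `s < 0`, with `⟪curl v(s)(y), e₃⟫ = 0`: `⟪Dv(s,y)[curl v(s,y)], e₃⟫ ≤ 0`.  (`ω₃ ≥ 0` has a minimum at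
`(s, y)`: `∂ₛω₃ = 0`, `∇ω₃ = 0`, `Δω₃ ≥ 0` there, and the `e₃`-vorticity equation `∂ₛω₃ = Δω₃ − Dω₃[v] + σ` gives
`σ = −Δω₃ ≤ 0`.) [cite: MajdaBertozziCUP2002, Prop. 2.4 eq. (2.110); folklore] -/
theorem inner_stretch_nonpos_of_inner_curl_e3_eq_zero {v : ℝ → EuclideanSpace ℝ (Fin 3) → EuclideanSpace ℝ (Fin 3)}
    (hrate : HasTypeITimeDecay C v) (hcont : ContinuousOn (uncurry v) (Iio (0 : ℝ) ×ˢ univ))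
    (hmild : ∀ s t : ℝ, s < t → t < 0 → ∀ x,
      v t x = UnboundedOperators.heatExtension (v s) (t - s) x - oseenDuhamel 1 s v v t x)
    (hdiv : ∀ t < 0, VectorCalculus.IsDivFree (v t)) (hnn : ∀ s < 0, ∀ y, 0 ≤ ⟪curl (v s) y, e3⟫)
    {s : ℝ} (hs : s < 0) {y : EuclideanSpace ℝ (Fin 3)} (hzero : ⟪curl (v s) y, e3⟫ = 0) :
    ⟪fderiv ℝ (v s) y (curl (v s) y), e3⟫ ≤ 0 := by
  obtain ⟨q, hcl⟩ := exists_classical_of_class hrate hcont hmild hdiv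
  have hS : IsOpen (Iio (0 : ℝ)) := isOpen_Iio
  have hV : IsVorticitySolutionOn (Iio (0 : ℝ)) 1 v :=
    hcl.isVorticitySolutionOn_zero_force hS.uniqueDiffOn (by rw [interior_Iio]; exact subset_closure)
  have hω : IsSmoothSpaceTimeOn (Iio (0 : ℝ)) (vorticity v) :=
    hV.smooth_velocity.isSmoothSpaceTimeOn_vorticity hS.uniqueDiffOn
  have hω3s : IsSmoothSpaceTimeOn (Iio (0 : ℝ)) fun t z => ⟪curl (v t) z, e3⟫ :=
    hω.inner (isSmoothSpaceTimeOn_const_time contDiff_const _)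
  -- space: `g = ω₃(s, ·) ≥ 0 = g y`
  set g : EuclideanSpace ℝ (Fin 3) → ℝ := fun z => ⟪curl (v s) z, e3⟫ with hg
  have hg2 : ContDiff ℝ 2 g := (hω3s.contDiff_slice hs).of_le (by norm_cast)
  have hmin : IsLocalMin g y := Filter.Eventually.of_forall fun z => by
    simp only [hg]; rw [hzero]; exact hnn s hs z
  have hgrad : fderiv ℝ g y = 0 := hmin.fderiv_eq_zero
  have hlap : 0 ≤ (Δ g) y := by
    have hmax : IsLocalMax ((-1 : ℝ) • g) y := by
      filter_upwards [hmin] with z hz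
      simp only [Pi.smul_apply, smul_eq_mul]
      linarith
    have hsm : ContDiff ℝ 2 ((-1 : ℝ) • g) := hg2.const_smul (-1 : ℝ)
    have h := IsLocalMax.laplacian_nonpos (W := (-1 : ℝ) • g) hsm hmax
    rw [InnerProductSpace.laplacian_smul _ hg2.contDiffAt, smul_eq_mul] at h
    linarith
  -- time: `t ↦ ω₃(t, y) ≥ 0 = ω₃(s, y)` near `s`
  have hD := hasDerivAt_inner_curl_e3 hV hs y
  have htmin : IsLocalMin (fun t => ⟪curl (v t) y, e3⟫) s := by
    filter_upwards [Iio_mem_nhds hs] with t ht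
    rw [hzero]; exact hnn t ht y
  have htime := htmin.hasDerivAt_eq_zero hD
  have hdrift : fderiv ℝ (fun z => ⟪curl (v s) z, e3⟫) y (v s y) = 0 := by
    change fderiv ℝ g y (v s y) = 0
    simp [hgrad]
  rw [hdrift] at htime
  change (Δ g) y - 0 + ⟪fderiv ℝ (v s) y (curl (v s) y), e3⟫ = 0 at htime
  linarith

/-- **CRITICAL-STRETCHING EXCLUSION, hypothesis on the support only.**  A closed-hemisphere profile of the class with
`(−s)·⟪Dv(s,y)[curl v(s,y)], e₃⟫ ≤ ⟪curl v(s,y), e₃⟫` at every `(s, y)` where `⟪curl v(s,y), e₃⟫ > 0` is poloidal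
along `e₃` (at the zeros the bound is automatic by `inner_stretch_nonpos_of_inner_curl_e3_eq_zero`).
[cite: Lieberman1996, Ch. II Thm. 2.7; folklore] -/
theorem inner_curl_e3_eq_zero_of_critical_stretching_on_pos
    {v : ℝ → EuclideanSpace ℝ (Fin 3) → EuclideanSpace ℝ (Fin 3)}
    (hrate : HasTypeITimeDecay C v) (hcont : ContinuousOn (uncurry v) (Iio (0 : ℝ) ×ˢ univ))
    (hmild : ∀ s t : ℝ, s < t → t < 0 → ∀ x,
      v t x = UnboundedOperators.heatExtension (v s) (t - s) x - oseenDuhamel 1 s v v t x)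
    (hdiv : ∀ t < 0, VectorCalculus.IsDivFree (v t)) (hnn : ∀ s < 0, ∀ y, 0 ≤ ⟪curl (v s) y, e3⟫)
    (hcrit : ∀ s < 0, ∀ y, 0 < ⟪curl (v s) y, e3⟫ →
      (-s) * ⟪fderiv ℝ (v s) y (curl (v s) y), e3⟫ ≤ ⟪curl (v s) y, e3⟫) :
    ∀ s < 0, ∀ y, ⟪curl (v s) y, e3⟫ = 0 := by
  refine inner_curl_e3_eq_zero_of_critical_stretching C v hrate hcont hmild hdiv hnn fun s hs y => ?_
  rcases (hnn s hs y).lt_or_eq with hpos | hzero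
  · exact hcrit s hs y hpos
  · have h := inner_stretch_nonpos_of_inner_curl_e3_eq_zero hrate hcont hmild hdiv hnn hs hzero.symm
    rw [← hzero]
    nlinarith [neg_pos.2 hs]

/-- **Census form (contrapositive): circulation-carrying closed-hemisphere profiles are stretched STRICTLY FASTER than
the similarity rate somewhere.**  If a closed-hemisphere profile of the class has `⟪curl v(s₀,y₀), e₃⟫ > 0` at one
point, then at some `(s, y)`, `s < 0`, with `⟪curl v(s,y), e₃⟫ > 0`:
`⟪curl v(s,y), e₃⟫ < (−s)·⟪Dv(s,y)[curl v(s,y)], e₃⟫`.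
[cite: Lieberman1996, Ch. II Thm. 2.7; folklore] -/
theorem exists_strictly_supercritical_stretching_of_pos {v : ℝ → EuclideanSpace ℝ (Fin 3) → EuclideanSpace ℝ (Fin 3)}
    (hrate : HasTypeITimeDecay C v) (hcont : ContinuousOn (uncurry v) (Iio (0 : ℝ) ×ˢ univ))
    (hmild : ∀ s t : ℝ, s < t → t < 0 → ∀ x,
      v t x = UnboundedOperators.heatExtension (v s) (t - s) x - oseenDuhamel 1 s v v t x)
    (hdiv : ∀ t < 0, VectorCalculus.IsDivFree (v t))
    (hnn : ∀ s < 0, ∀ y, 0 ≤ ⟪curl (v s) y, e3⟫) {s₀ : ℝ} (hs₀ : s₀ < 0) {y₀ : EuclideanSpace ℝ (Fin 3)}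
    (hpos : 0 < ⟪curl (v s₀) y₀, e3⟫) :
    ∃ s : ℝ, s < 0 ∧ ∃ y, 0 < ⟪curl (v s) y, e3⟫ ∧
      ⟪curl (v s) y, e3⟫ < (-s) * ⟪fderiv ℝ (v s) y (curl (v s) y), e3⟫ := by
  by_contra hcon
  push Not at hcon
  have h := inner_curl_e3_eq_zero_of_critical_stretching_on_pos hrate hcont hmild hdiv hnn
    (fun s hs y hp => hcon s hs y hp) s₀ hs₀ y₀
  linarith

end Summit.NavierStokesRegularity.NavierStokesRegularity.Theorems.HalfSpaceWindowDoorCirculationCarryingRigidityCriticalStretching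

end
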